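import Summits.HodgeConjecture.HodgeConjecture.Theorems.VHCAbelianSchemesRoadIsogenyPushforwardUnitRank
import Summits.Ventures.HSemireg.HomComplexSupertracePushforward
import Literature.AlgebraicGeometry.Modules.PushforwardTraceTransitive
import HarnessLib

/-!
# Road №4 (`VHCAbelianSchemesRoad`) — (T2•) PROVED for the route-K bricks and the CLOSER of (c1Tr): the supertrace transitivity
# `κ ≫ 𝓗om•(g_*•E, α_q) ≫ Tr•^H_{g_*•E} = g_*•(Tr•^H_E) ≫ Θ_q•` for `α₀ = isogenyTwistPushforwardIsoFamily hΩ` and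
# `Θ_q = isogenyFormsTraceSingle` (crux stmt-HodgeConjecture-26512, input (c1Tr))

research route conditional on HC_CM; not a corollary; Q11.4-sentence-2 already refuted in dim ≥ 3.

Seat core-w6 gen 1 (director-hodge g16 req-44 ∕ R16.32 (2): «(T2•) for the route-K bricks instance + the closer»). `--supports
stmt-HodgeConjecture-26512 --as helper`; closes NO stub or item; CONDITIONAL on the named fact «`Ω¹_A` free»
(`hΩ : Mumford1970_cotangentSheaf_abelianVariety_free`) only, as a hypothesis; nothing here says (c1Tr), (c1), T′, 26512, `HC_AV`,
`HC_CM` or HC holds; HC_CM HELD, by name only; typed ≠ proved.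

WHAT IS PROVED.
* §1 (module level, twisted) `sheafHomPushforwardComparison_comp_map_twistIso_comp_contract`: for an isogeny `g`, a finite locally free `F`
  with `g_*F` finite locally free, and every `q`,
  `(g_*𝓗om(F, F ⊗ Ω^q) → 𝓗om(g_*F, g_*(F ⊗ Ω^q))) ≫ 𝓗om(g_*F, α_q(g)(F)) ≫ contract_{g_*F, Ω^q} = g_*(contract_{F, Ω^q}) ≫ Θ_q(g)` —
  in the frame coordinate `K` of `Ω^q_A` (w6 g0's `isogenyTwistHodgePushforwardIso_hom_comp_twistFreeIso_π` and (P3)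
  `isogenyFormsTrace_comp_frame_π`) both sides are `g_*(𝓗om(F, 𝓗om(F^∨, θ ≫ coord_K)) ≫ contract) ≫ (…)`, and the residue is EXACTLY the
  TRANSITIVITY OF THE TRACE `g_*(tr_F) ≫ Trace_g = (g_*𝓗om(F,F) → 𝓗om(g_*F, g_*F)) ≫ tr_{g_*F}` — the Literature theorem
  `Modules.map_trace_comp_pushforwardTrace` (Bourbaki A III §9 no. 4 Prop. 6, proved there for affine `f` WITHOUT framing `F`:
  projective coordinate systems over affine opens + cyclicity of the trace).
* §2 (complex level) **`kappaData_comp_map_comp_supertraceH_routeK`** = the hypothesis `hT2` of core-w1's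
  `tracePushforwardCompatPair_routeK_of_residual` (p656892) ∕ the field `κ_comp_map_comp_supertraceH` of core-w2's `TracePushforwardBricks`
  VERBATIM for `α := isogenyTwistPushforwardIsoFamily hΩ`, `Θ := isogenyFormsTraceSingle hΩ A g h q` (`…_holds`: at the canonical `h`): a morphism into the single complex
  `Ω^q_A[0]` — compare degree-`0` components summand by summand (`pushforward_ι_kappa_hom_ext`, template = venture
  `HomComplex.map_supertraceH_comp`); on `𝓗om(E^{-i}, E^{-i} ⊗ Ω^q)` both sides are `(-1)^i ×` §1.
* §3 **`tracePushforwardCompatPair_routeK (hfin) : ∀ hΩ, TracePushforwardCompatPair isogenyDerivedAdjointPairOfRouteK (isogenyTwistPushforwardIsoFamily hΩ)`**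
  — THE CLOSER of (c1Tr) (`stub_tracePair` with `hfin` first): core-w1's `tracePushforwardCompatPair_routeK_of_residual` ∘ {Θ_q (core-w6 g0), (T2•) §2,
  core-qb's `rho_routeK_injective_of_isIsogeny` ((G1)+(G2), degree framing discharged)}. Displayed: the two named facts `hfin`, `hΩ`; nothing else.

References: [cite: BourbakiAlgebraI1989, III §9 no. 4 Prop. 6 (24) and II §4 no. 3 Prop. 3 (20)] [cite: BuchweitzFlenner2003, §4 (trace map) and Def. 4.1]
[cite: StacksProject, Tag 0BVH] [cite: Hartshorne1977, II Ex. 5.1 (a), (b), (d)] [cite: MumfordAV1970, §4 (iii) (p. 42) and §7 Thm. 4 (p. 72)].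
-/

noncomputable section

-- `TopCat.Presheaf`/`Scheme.Modules`/`GradedObject` are not reducible (as in Mathlib's `AlgebraicGeometry/Modules/Sheaf.lean`).
set_option backward.isDefEq.respectTransparency false

open CategoryTheory CategoryTheory.Category CategoryTheory.Limits AlgebraicGeometry Opposite
open AlgebraicGeometry.Scheme.Modules

namespace Summit.HodgeConjecture.HodgeConjecture.Ring2.SemiregularRepresentatives

set_option linter.dupNamespace false -- the cell's namespace repeats the summit name, as in every `Ring2*` file

open Literature.AlgebraicGeometry Literature.AlgebraicGeometry.Modules Literature.AlgebraicGeometry.Motives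
open Literature.AlgebraicGeometry.Motives.AbelianVariety
open Summit.Ventures.HSemireg Summit.Ventures.HSemireg.HomComplex

/-! ## §1 Module level: `κ ≫ 𝓗om(g_*F, α_q(F)) ≫ contract = g_*(contract) ≫ Θ_q` -/

section Module

/-- An isogeny is an affine morphism (it is finite). [cite: MumfordAV1970, §7 Thm. 4 (p. 72)] -/
theorem isAffineHom_of_isIsogeny {A : AbelianVariety ℂ} {g : A ⟶ A} (hg : IsIsogeny g) : IsAffineHom (Hom.toSchemeHom g) := by
  haveI := hg.2
  infer_instance

/-- `𝓗om(F, m) ≫ tr_F = contract_{F, G} ≫ c` for `m = 𝓗om(F^∨, c) ≫ (F ≅ F^∨∨)⁻¹ : F ⊗ G → F` (`c : G → 𝒪`): the trace after "contracting the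
coefficient `c`" is the contraction followed by `c`. [cite: Hartshorne1977, II Ex. 5.1 (a), (b)] [cite: BourbakiAlgebraI1989, II §4 no. 3 (16)–(17)] -/
theorem sheafHomMap_dualCoeff_comp_trace {X : Scheme.{0}} {F G : X.Modules} (hF : IsFiniteLocallyFree F) [IsIso (toBidual F (unitModule X))]
    (c : G ⟶ unitModule X) :
    sheafHomMap F (sheafHomMap (dual F) c ≫ inv (toBidual F (unitModule X))) ≫ trace hF = contract hF G ≫ c := by
  rw [trace, endToBidual, ← Category.assoc, ← sheafHomMap_comp, Category.assoc, IsIso.inv_hom_id, Category.comp_id,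
    HodgeTheory.sheafHomMap_sheafHomMap_comp_contract]

/-- **(T2) at module level, twisted by `Ω^q`**: for an isogeny `g`, `F` finite locally free with `g_*F` finite locally free (`hF'`, ANY proof)
and `g_*𝒪_A` finite locally free (`h`),
`(g_*𝓗om(F, F ⊗ Ω^q) → 𝓗om(g_*F, g_*(F ⊗ Ω^q))) ≫ 𝓗om(g_*F, α_q(g)(F)) ≫ contract_{g_*F, Ω^q} = g_*(contract_{F, Ω^q}) ≫ Θ_q(g)`.
Frame coordinates reduce it to the transitivity of the trace `Modules.map_trace_comp_pushforwardTrace`. CONDITIONAL on `hΩ`.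
[cite: BourbakiAlgebraI1989, III §9 no. 4 Prop. 6 (24)] [cite: Hartshorne1977, II Ex. 5.1 (b), (d)] [cite: StacksProject, Tag 0BVH] -/
theorem sheafHomPushforwardComparison_comp_map_twistIso_comp_contract (hΩ : Mumford1970_cotangentSheaf_abelianVariety_free)
    (A : AbelianVariety ℂ) (g : A ⟶ A) (hg : IsIsogeny g) (q : ℕ) (F : A.X.left.Modules) (hF : IsFiniteLocallyFree F)
    (hF' : IsFiniteLocallyFree ((pushforward (Hom.toSchemeHom g)).obj F))
    (h : IsFiniteLocallyFree ((pushforward (Hom.toSchemeHom g)).obj (unitModule A.X.left))) :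
    sheafHomPushforwardComparison (Hom.toSchemeHom g) F (HodgeTheory.twistHodge F q) ≫
        sheafHomMap ((pushforward (Hom.toSchemeHom g)).obj F) (isogenyTwistHodgePushforwardIso hΩ A g hg q F hF).hom ≫
          contract hF' (hodgeSheaf A.X q) =
      (pushforward (Hom.toSchemeHom g)).map (contract hF (hodgeSheaf A.X q)) ≫ isogenyFormsTrace hΩ A g h q := by
  haveI := isIso_toBidual F hF
  haveI := isIso_toBidual ((pushforward (Hom.toSchemeHom g)).obj F) hF'
  haveI := isAffineHom_of_isIsogeny hg
  -- compare the frame coordinates `K` of `Ω^q_A`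
  rw [← cancel_mono (hodgeSheafFrame hΩ A q).hom]
  refine Limits.Pi.hom_ext _ _ fun K => ?_
  simp only [Category.assoc]
  rw [isogenyFormsTrace_comp_frame_π, ← Functor.map_comp_assoc,
    ← HodgeTheory.sheafHomMap_sheafHomMap_comp_contract hF' ((hodgeSheafFrame hΩ A q).hom ≫ Pi.π _ K),
    ← Category.assoc (sheafHomMap _ _), ← sheafHomMap_comp]
  -- the coefficient map `𝓗om((g_*F)^∨, coord_K)` through the frame components of `α_q(g)(F)`
  have hc : (isogenyTwistHodgePushforwardIso hΩ A g hg q F hF).hom ≫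
      sheafHomMap (dual ((pushforward (Hom.toSchemeHom g)).obj F)) ((hodgeSheafFrame hΩ A q).hom ≫ Pi.π _ K) =
      (pushforward (Hom.toSchemeHom g)).map (sheafHomMap (dual F) ((isogenyFormsTwist hΩ A g q).hom ≫
          ((hodgeSheafFrame hΩ A q).hom ≫ Pi.π _ K)) ≫ inv (toBidual F (unitModule _))) ≫
        toBidual ((pushforward (Hom.toSchemeHom g)).obj F) (unitModule _) := by
    rw [← isogenyTwistHodgePushforwardIso_hom_comp_twistFreeIso_π hΩ A g hg q F hF K, Category.assoc, Category.assoc,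
      twistFreeIso_hom_π_assoc, IsIso.inv_hom_id, Category.comp_id]
  rw [hc, sheafHomMap_comp ((pushforward (Hom.toSchemeHom g)).obj F), Category.assoc,
    ← reassoc_of% (pushforward_map_sheafHomMap_comp_comparison (Hom.toSchemeHom g) F
      (sheafHomMap (dual F) ((isogenyFormsTwist hΩ A g q).hom ≫ ((hodgeSheafFrame hΩ A q).hom ≫ Pi.π _ K)) ≫
        inv (toBidual F (unitModule _))))]
  -- `𝓗om(g_*F, toBidual) ≫ contract = tr_{g_*F}`; transitivity of the trace; `𝓗om(F, m_K) ≫ tr_F = contract ≫ θ ≫ coord_K`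
  change _ ≫ _ ≫ trace hF' = _
  rw [← map_trace_comp_pushforwardTrace (Hom.toSchemeHom g) hF h hF', ← Functor.map_comp_assoc,
    sheafHomMap_dualCoeff_comp_trace hF]

end Module

/-! ## §2 Complex level: (T2•) for the route-K bricks -/

section Complex

variable {A : AbelianVariety ℂ} {g : A ⟶ A}

/-- The right summand: `g_*(ι_{-i,i}) ≫ g_*(𝓗om•(E, (E⊗Ω^q ≅ E⊗G))_0) ≫ g_*(str₀) = (-1)^i • g_*(contract_{E^{-i}, Ω^q})` (the venture's
`map_ι_comp_map_str₀` along ANY morphism). [cite: BuchweitzFlenner2003, §4 (trace map)] -/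
theorem map_ι_comp_map_str₀_routeK (E : CochainComplex A.X.left.Modules ℤ) (hE : ∀ i, IsFiniteLocallyFree (E.X i)) (q : ℕ)
    (i : ℤ) (hi : -i + i = 0) :
    (pushforward (Hom.toSchemeHom g)).map (ι A.X.left E (twistHodgeComplex A.X q E) (-i) i 0 hi) ≫
        (pushforward (Hom.toSchemeHom g)).map (((homFunctor A.X.left E).map (twistHodgeIsoG A.X E q).hom).f 0) ≫
          (pushforward (Hom.toSchemeHom g)).map (str₀ A.X.left (hodgeSheaf A.X q) E hE) =
      (i.negOnePow : ℤ) • (pushforward (Hom.toSchemeHom g)).map (contract (hE (-i)) (hodgeSheaf A.X q)) := by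
  rw [← Functor.map_comp, ← Functor.map_comp, homFunctor_map_f,
    reassoc_of% (ι_map A.X.left E (twistHodgeIsoG A.X E q).hom (-i) i 0 hi), ι_str₀]
  erw [show (twistHodgeIsoG A.X E q).hom.f (-i) = 𝟙 _ from rfl, sheafHomMap_id, Category.id_comp]
  simp only [strComp, HomologicalComplex.XIsoOfEq_rfl, Iso.refl_hom, sheafHomMap_id, Category.id_comp, Units.smul_def,
    Functor.map_zsmul]

/-- The components of `α₀ = isogenyTwistPushforwardIsoFamily hΩ` (core-w6's (L7b) datum): `α_q(g)(E•)_i = α_q(g)(E^i)`. [folklore] -/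
theorem isogenyTwistPushforwardIsoFamily_hom_f (hΩ : Mumford1970_cotangentSheaf_abelianVariety_free) (hg : IsIsogeny g) (q : ℕ)
    (E : CochainComplex A.X.left.Modules ℤ) (hE : ∀ i, IsFiniteLocallyFree (E.X i)) (i : ℤ) :
    (isogenyTwistPushforwardIsoFamily hΩ A g hg q E hE).hom.f i = (isogenyTwistHodgePushforwardIso hΩ A g hg q (E.X i) (hE i)).hom :=
  rfl

/-- The left summand: `g_*(ι_{-i,i}) ≫ κ_0 ≫ 𝓗om•(g_*•E, α_q)_0 ≫ 𝓗om•(g_*•E, ≅)_0 ≫ str₀' = (-1)^i • (cmp ≫ 𝓗om(g_*E^{-i}, α_q(E^{-i})) ≫ contract)`.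
[cite: BuchweitzFlenner2003, §4 (trace map)] [cite: StacksProject, Tag 01CM] -/
theorem map_ι_comp_kappaData_comp_str₀ (hΩ : Mumford1970_cotangentSheaf_abelianVariety_free) (hg : IsIsogeny g)
    (E : CochainComplex A.X.left.Modules ℤ) (a b : ℤ) [E.IsStrictlyGE a] [E.IsStrictlyLE b]
    (hE : ∀ i, IsFiniteLocallyFree (E.X i)) (hE' : ∀ i, IsFiniteLocallyFree ((endoPushforwardComplex A g E).X i)) (q : ℕ)
    (i : ℤ) (hi : -i + i = 0) :
    (pushforward (Hom.toSchemeHom g)).map (ι A.X.left E (twistHodgeComplex A.X q E) (-i) i 0 hi) ≫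
        (kappaData A g E (twistHodgeComplex A.X q E) a b).f 0 ≫
          (((homFunctor A.X.left (endoPushforwardComplex A g E)).map
              (isogenyTwistPushforwardIsoFamily hΩ A g hg q E hE).hom).f 0) ≫
            (((homFunctor A.X.left (endoPushforwardComplex A g E)).map
                (twistHodgeIsoG A.X (endoPushforwardComplex A g E) q).hom).f 0) ≫
              str₀ A.X.left (hodgeSheaf A.X q) (endoPushforwardComplex A g E) hE' =
      (i.negOnePow : ℤ) • (sheafHomPushforwardComparison (Hom.toSchemeHom g) (E.X (-i)) (HodgeTheory.twistHodge (E.X (-i)) q) ≫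
        sheafHomMap ((pushforward (Hom.toSchemeHom g)).obj (E.X (-i))) (isogenyTwistHodgePushforwardIso hΩ A g hg q (E.X (-i)) (hE (-i))).hom ≫
          contract (hE' (-i)) (hodgeSheaf A.X q)) := by
  rw [reassoc_of% (map_ι_comp_kappaData_f A g E (twistHodgeComplex A.X q E) a b (-i) i 0 hi), homFunctor_map_f, homFunctor_map_f,
    reassoc_of% (ι_map A.X.left (endoPushforwardComplex A g E) (isogenyTwistPushforwardIsoFamily hΩ A g hg q E hE).hom (-i) i 0 hi),
    reassoc_of% (ι_map A.X.left (endoPushforwardComplex A g E) (twistHodgeIsoG A.X (endoPushforwardComplex A g E) q).hom (-i) i 0 hi),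
    ι_str₀, isogenyTwistPushforwardIsoFamily_hom_f]
  erw [show (twistHodgeIsoG A.X (endoPushforwardComplex A g E) q).hom.f (-i) = 𝟙 _ from rfl, sheafHomMap_id, Category.id_comp]
  simp only [strComp, HomologicalComplex.XIsoOfEq_rfl, Iso.refl_hom, sheafHomMap_id, Category.id_comp, Units.smul_def,
    Preadditive.comp_zsmul]
  rfl

/-- **(T2•) PROVED for the route-K bricks** — the field `κ_comp_map_comp_supertraceH` of `TracePushforwardBricks` ∕ the hypothesis `hT2` of
`tracePushforwardCompatPair_routeK_of_residual` VERBATIM, for `α_q := isogenyTwistPushforwardIsoFamily hΩ A g hg q E hE` and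
`Θ := isogenyFormsTraceSingle hΩ A g h q` (ANY proof `h` that `g_*𝒪_A` is finite locally free):
`κ ≫ 𝓗om•(g_*•E, α_q) ≫ Tr•^H_{g_*•E} = g_*•(Tr•^H_E) ≫ Θ_q•` as morphisms `g_*•𝓗om•(E, E ⊗ Ω^q_A) ⟶ Ω^q_A[0]` (degree-`0` components, summand by
summand, are `(-1)^i ×` §1). CONDITIONAL on `hΩ`. [cite: BuchweitzFlenner2003, §4 (trace map) and Def. 4.1] [cite: BourbakiAlgebraI1989, III §9 no. 4 Prop. 6 (24)]
[cite: StacksProject, Tag 0BVH] -/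
theorem kappaData_comp_map_comp_supertraceH_routeK (hΩ : Mumford1970_cotangentSheaf_abelianVariety_free) (hg : IsIsogeny g)
    (E : CochainComplex A.X.left.Modules ℤ) (a b : ℤ) [E.IsStrictlyGE a] [E.IsStrictlyLE b]
    (hE : ∀ i, IsFiniteLocallyFree (E.X i)) (hE' : ∀ i, IsFiniteLocallyFree ((endoPushforwardComplex A g E).X i)) (q : ℕ)
    (h : IsFiniteLocallyFree ((pushforward (Hom.toSchemeHom g)).obj (unitModule A.X.left))) :
    kappaData A g E (twistHodgeComplex A.X q E) a b ≫
        (homFunctor A.X.left (endoPushforwardComplex A g E)).map (isogenyTwistPushforwardIsoFamily hΩ A g hg q E hE).hom ≫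
          supertraceH A.X (endoPushforwardComplex A g E) hE' q =
      ((pushforward (Hom.toSchemeHom g)).mapHomologicalComplex (ComplexShape.up ℤ)).map (supertraceH A.X E hE q) ≫
        isogenyFormsTraceSingle hΩ A g h q := by
  refine HomologicalComplex.to_single_hom_ext ?_
  rw [isogenyFormsTraceSingle]
  simp only [HomologicalComplex.comp_f, Functor.mapHomologicalComplex_map_f, Iso.app_hom,
    HomologicalComplex.singleMapHomologicalComplex_hom_app_self, HomologicalComplex.single_map_f_self, Category.assoc,
    Iso.inv_hom_id_assoc, supertraceH_f_zero, Functor.map_comp, Iso.map_inv_hom_id_assoc]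
  refine pushforward_ι_kappa_hom_ext A g E a b fun p i hpi => ?_
  obtain rfl : p = -i := by omega
  rw [reassoc_of% (map_ι_comp_map_str₀_routeK E hE q i hpi), reassoc_of% (map_ι_comp_kappaData_comp_str₀ hΩ hg E a b hE hE' q i hpi)]
  simp only [Preadditive.zsmul_comp, Category.assoc]
  rw [reassoc_of% (sheafHomPushforwardComparison_comp_map_twistIso_comp_contract hΩ A g hg q (E.X (-i)) (hE (-i)) (hE' (-i)) h)]

/-- (T2•) at the canonical proof that `g_*𝒪_A` is finite locally free — LITERALLY the hypothesis `hT2 A g hg E a b hE hE' q` of core-w1's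
`tracePushforwardCompatPair_routeK_of_residual` with `Θ A g hg q := isogenyFormsTraceSingle hΩ A g (isogenyPushforwardFiniteLocallyFree_holds …) q`.
CONDITIONAL on `hΩ`. [cite: BuchweitzFlenner2003, §4 (trace map) and Def. 4.1] [cite: BourbakiAlgebraI1989, III §9 no. 4 Prop. 6 (24)] -/
theorem kappaData_comp_map_comp_supertraceH_routeK_holds (hΩ : Mumford1970_cotangentSheaf_abelianVariety_free) (hg : IsIsogeny g)
    (E : CochainComplex A.X.left.Modules ℤ) (a b : ℤ) [E.IsStrictlyGE a] [E.IsStrictlyLE b]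
    (hE : ∀ i, IsFiniteLocallyFree (E.X i)) (hE' : ∀ i, IsFiniteLocallyFree ((endoPushforwardComplex A g E).X i)) (q : ℕ) :
    kappaData A g E (twistHodgeComplex A.X q E) a b ≫
        (homFunctor A.X.left (endoPushforwardComplex A g E)).map (isogenyTwistPushforwardIsoFamily hΩ A g hg q E hE).hom ≫
          supertraceH A.X (endoPushforwardComplex A g E) hE' q =
      ((pushforward (Hom.toSchemeHom g)).mapHomologicalComplex (ComplexShape.up ℤ)).map (supertraceH A.X E hE q) ≫
        isogenyFormsTraceSingle hΩ A g
          (isogenyPushforwardFiniteLocallyFree_holds ℂ A A g hg (unitModule _) isFiniteLocallyFree_unitModule) q :=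
  kappaData_comp_map_comp_supertraceH_routeK hΩ hg E a b hE hE' q _

end Complex

/-! ## §3 The closer of (c1Tr): `stub_tracePair` from the two registered textbook facts -/

section Closer

/-- **(c1Tr) CLOSED MODULO THE TWO TEXTBOOK FACTS — `TracePushforwardCompatPair isogenyDerivedAdjointPairOfRouteK (isogenyTwistPushforwardIsoFamily hΩ)`
for every `hΩ`, GIVEN `hfin`** (the statement of `stub_tracePair` of skeleton v3.14 with `hfin` FIRST, R16.31 (2)): core-w1's
`tracePushforwardCompatPair_routeK_of_residual` (p656892) fed with `Θ_q := isogenyFormsTraceSingle` (core-w6 p655895), (T2•) = §2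
(`kappaData_comp_map_comp_supertraceH_routeK_holds`), and the injectivity of the Gysin maps `ρ_q` = core-qb's `rho_routeK_injective_of_isIsogeny`
(p658036 ∕ p659243: (G1) split by `g^♯•`, degree framing from irreducibility, (G2) finite-dimensionality from `hfin`). CONDITIONAL on exactly the two
NAMED FACTS `hfin : GortzWedhorn2023_cohomology_proper_coherent_finite` [GW II Cor. 23.18] and `hΩ : Mumford1970_cotangentSheaf_abelianVariety_free`
[Mumford AV §4 (iii)], both displayed as hypotheses; nothing else; closes no item by itself (the LEAD binds `stub_tracePair`); HC_CM untouched.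
[cite: BuchweitzFlenner2003, §3–§4 and Def. 4.1] [cite: GortzWedhorn2023, Cor. 23.18 (p. 425)] [cite: MumfordAV1970, §4 (iii) (p. 42) and §7 Thm. 4 (p. 72)]
[cite: StacksProject, Tag 0BVH] [cite: BourbakiAlgebraI1989, III §9 no. 4 Prop. 6 (24)] -/
theorem tracePushforwardCompatPair_routeK (hfin : Literature.AlgebraicGeometry.Morphisms.GortzWedhorn2023_cohomology_proper_coherent_finite) :
    ∀ hΩ : Mumford1970_cotangentSheaf_abelianVariety_free,
      TracePushforwardCompatPair isogenyDerivedAdjointPairOfRouteK (isogenyTwistPushforwardIsoFamily hΩ) :=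
  fun hΩ => tracePushforwardCompatPair_routeK_of_residual (isogenyTwistPushforwardIsoFamily hΩ)
    (fun A g hg q => isogenyFormsTraceSingle hΩ A g
      (isogenyPushforwardFiniteLocallyFree_holds ℂ A A g hg (unitModule _) isFiniteLocallyFree_unitModule) q)
    (fun _ _ hg E a b _ _ hE hE' q => kappaData_comp_map_comp_supertraceH_routeK_holds hΩ hg E a b hE hE' q)
    (fun _ _ hg E a b _ _ hE hE' q => rho_routeK_injective_of_isIsogeny hΩ hg _ E a b hE hE' q _ hfin)

end Closer

end Summit.HodgeConjecture.HodgeConjecture.Ring2.SemiregularRepresentatives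

end
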